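import Mathlib
import Summits.Ventures.PercRepro2.IFRTail

/-!
# Two-dimensional M♮-concave tails (seat mine-b, cell pub-perc-repro2)

The two-copy tail `T(a, b) = #{S : r(S) ≥ a, b(S) ≥ b}` of a finite two-terminal network (red flow `r`, blue
flow `b` of a 2-colouring `S`) is, on the census of conjectures/MINE-B.md §30.12, log-M♮-concave on `ℤ²`
(conjecture (TAIL-M♮)).  On the clipped tail (`T a b = T (max a 0) (max b 0)`) M♮-concavity of `log T` is
the conjunction of three local inequalities (m1, m2, m4 below; agreement with the exchange-axiom test on
4,000 / 4,000 random laws), and the tail of a law on the triangle `{i + j ≤ L}` with a full top level is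
positive exactly on `{a⁺ + b⁺ ≤ L}`.  `IsMTail T L` packages these facts.

This file: the structure, its elementary consequences (monotonicity, the interval structure of the support
along the anti-diagonal direction `w = (1, -1)`, the iterated skew inequalities), closure under pointwise
products (the SERIES step of the tail calculus: `T_{X ∧ Y} = T_X · T_Y`), and the cross lemma behind the
bundle step (`Tail2DBundle.lean`).
-/

open Finset

namespace Summit.Ventures.PercRepro2.Tail2D

/-- the clipped two-dimensional tail of a law on the triangle `{i + j ≤ L}` with a full top level, whose
logarithm is M♮-concave: clipping, positivity exactly on `{a⁺ + b⁺ ≤ L}`, monotonicity, and the three local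
exchange inequalities `m1` (log-submodularity), `m2` (`Δ₁ log T` non-increasing along `(1, -1)`) and `m4`
(`Δ₂ log T` non-increasing along `(-1, 1)`). -/
structure IsMTail (T : ℤ → ℤ → ℝ) (L : ℤ) : Prop where
  L_nonneg : 0 ≤ L
  clip₁ : ∀ a b, a ≤ 0 → T a b = T 0 b
  clip₂ : ∀ a b, b ≤ 0 → T a b = T a 0
  pos : ∀ a b, max a 0 + max b 0 ≤ L → 0 < T a b
  zero : ∀ a b, L < max a 0 + max b 0 → T a b = 0
  anti₁ : ∀ a b, T (a + 1) b ≤ T a b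
  anti₂ : ∀ a b, T a (b + 1) ≤ T a b
  m1 : ∀ a b, T (a + 1) (b + 1) * T a b ≤ T (a + 1) b * T a (b + 1)
  m2 : ∀ a b, T (a + 2) (b - 1) * T a b ≤ T (a + 1) b * T (a + 1) (b - 1)
  m4 : ∀ a b, T (a - 1) (b + 2) * T a b ≤ T a (b + 1) * T (a - 1) (b + 1)

namespace IsMTail

variable {T : ℤ → ℤ → ℝ} {L : ℤ} (hT : IsMTail T L)

include hT

/-- the tail is non-negative -/
lemma nonneg (a b : ℤ) : 0 ≤ T a b := by
  by_cases h : max a 0 + max b 0 ≤ L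
  · exact (hT.pos a b h).le
  · rw [hT.zero a b (by omega)]

/-- positivity characterises the support -/
lemma pos_iff (a b : ℤ) : 0 < T a b ↔ max a 0 + max b 0 ≤ L := by
  constructor
  · intro h; by_contra hc; rw [hT.zero a b (by omega)] at h; exact lt_irrefl _ h
  · exact hT.pos a b

/-- `T a b = 0` iff `(a, b)` lies outside the triangle -/
lemma eq_zero_iff (a b : ℤ) : T a b = 0 ↔ L < max a 0 + max b 0 := by
  constructor
  · intro h; by_contra hc; have := hT.pos a b (by omega); rw [h] at this; exact lt_irrefl _ this
  · exact hT.zero a b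

/-- monotonicity in the first coordinate, many steps -/
lemma anti₁_of_le {a a' : ℤ} (h : a ≤ a') (b : ℤ) : T a' b ≤ T a b := by
  obtain ⟨n, rfl⟩ : ∃ n : ℕ, a' = a + n := ⟨(a' - a).toNat, by omega⟩
  induction n with
  | zero => simp
  | succ n ih =>
    have e : a + ((n + 1 : ℕ) : ℤ) = a + n + 1 := by push_cast; ring
    rw [e]; exact le_trans (hT.anti₁ (a + n) b) (ih (by omega))

/-- monotonicity in the second coordinate, many steps -/
lemma anti₂_of_le (a : ℤ) {b b' : ℤ} (h : b ≤ b') : T a b' ≤ T a b := by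
  obtain ⟨n, rfl⟩ : ∃ n : ℕ, b' = b + n := ⟨(b' - b).toNat, by omega⟩
  induction n with
  | zero => simp
  | succ n ih =>
    have e : b + ((n + 1 : ℕ) : ℤ) = b + n + 1 := by push_cast; ring
    rw [e]; exact le_trans (hT.anti₂ a (b + n)) (ih (by omega))

/-- the support is an interval along every line of direction `(1, -1)`: a zero between two positive
values is impossible -/
lemma interval {a b k₁ k₂ k₃ : ℤ} (h12 : k₁ ≤ k₂) (h23 : k₂ ≤ k₃)
    (h1 : 0 < T (a + k₁) (b - k₁)) (h3 : 0 < T (a + k₃) (b - k₃)) : 0 < T (a + k₂) (b - k₂) := by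
  rw [hT.pos_iff] at h1 h3 ⊢; omega

/-- if the line is zero at `k'` and positive at `k' + 1`, it is zero at every `k ≤ k'` -/
lemma zero_left {a b k k' : ℤ} (hk : k ≤ k') (h0 : T (a + k') (b - k') = 0)
    (h1 : 0 < T (a + (k' + 1)) (b - (k' + 1))) : T (a + k) (b - k) = 0 := by
  by_contra hne
  have hk0 : 0 < T (a + k) (b - k) := lt_of_le_of_ne (hT.nonneg _ _) (Ne.symm hne)
  have := hT.interval hk (by omega) hk0 h1
  rw [h0] at this; exact lt_irrefl _ this

/-- (m2) iterated along the lines through `(a, b)` and `(a + 1, b)`: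
`T (a+1+m') (b-m') * T (a+m) (b-m) ≤ T (a+1+m) (b-m) * T (a+m') (b-m')` for `m ≤ m'`
(the likelihood-ratio order of the two adjacent `w`-lines). -/
lemma m2_iter (a b : ℤ) {m m' : ℤ} (h : m ≤ m') :
    T (a + 1 + m') (b - m') * T (a + m) (b - m) ≤ T (a + 1 + m) (b - m) * T (a + m') (b - m') := by
  obtain ⟨d, rfl⟩ : ∃ d : ℕ, m' = m + d := ⟨(m' - m).toNat, by omega⟩
  induction d with
  | zero => simp
  | succ d ih =>
    have ih := ih (by omega)
    set m' := m + (d : ℤ) with hm'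
    have e1 : m + ((d + 1 : ℕ) : ℤ) = m' + 1 := by rw [hm']; push_cast; ring
    rw [e1]
    -- one step of m2 at the base point (a + m', b - m')
    have step : T (a + 1 + (m' + 1)) (b - (m' + 1)) * T (a + m') (b - m')
        ≤ T (a + 1 + m') (b - m') * T (a + (m' + 1)) (b - (m' + 1)) := by
      convert hT.m2 (a + m') (b - m') using 3 <;> ring
    by_cases hp : T (a + m') (b - m') = 0
    · by_cases hp1 : T (a + (m' + 1)) (b - (m' + 1)) = 0
      · rw [hp1, mul_zero]
        have hq : T (a + 1 + (m' + 1)) (b - (m' + 1)) = 0 := by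
          have := hT.anti₁ (a + (m' + 1)) (b - (m' + 1))
          have e : a + (m' + 1) + 1 = a + 1 + (m' + 1) := by ring
          rw [e, hp1] at this
          exact le_antisymm this (hT.nonneg _ _)
        rw [hq, zero_mul]
      · have hp1' : 0 < T (a + (m' + 1)) (b - (m' + 1)) := lt_of_le_of_ne (hT.nonneg _ _) (Ne.symm hp1)
        have hpm : T (a + m) (b - m) = 0 := hT.zero_left (by omega) hp hp1'
        rw [hpm, mul_zero]
        exact mul_nonneg (hT.nonneg _ _) (hT.nonneg _ _)
    · have hppos : 0 < T (a + m') (b - m') := lt_of_le_of_ne (hT.nonneg _ _) (Ne.symm hp)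
      -- chain: q_{m'+1} p_m p_{m'} ≤ q_{m'} p_{m'+1} p_m ≤ q_m p_{m'+1} p_{m'}
      have c1 : T (a + 1 + (m' + 1)) (b - (m' + 1)) * T (a + m) (b - m) * T (a + m') (b - m')
          ≤ T (a + 1 + m') (b - m') * T (a + (m' + 1)) (b - (m' + 1)) * T (a + m) (b - m) := by
        have := mul_le_mul_of_nonneg_right step (hT.nonneg (a + m) (b - m))
        calc T (a + 1 + (m' + 1)) (b - (m' + 1)) * T (a + m) (b - m) * T (a + m') (b - m')
            = T (a + 1 + (m' + 1)) (b - (m' + 1)) * T (a + m') (b - m') * T (a + m) (b - m) := by ring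
          _ ≤ _ := this
      have c2 : T (a + 1 + m') (b - m') * T (a + (m' + 1)) (b - (m' + 1)) * T (a + m) (b - m)
          ≤ T (a + 1 + m) (b - m) * T (a + (m' + 1)) (b - (m' + 1)) * T (a + m') (b - m') := by
        have := mul_le_mul_of_nonneg_right ih (hT.nonneg (a + (m' + 1)) (b - (m' + 1)))
        calc T (a + 1 + m') (b - m') * T (a + (m' + 1)) (b - (m' + 1)) * T (a + m) (b - m)
            = T (a + 1 + m') (b - m') * T (a + m) (b - m) * T (a + (m' + 1)) (b - (m' + 1)) := by ring
          _ ≤ T (a + 1 + m) (b - m) * T (a + m') (b - m') * T (a + (m' + 1)) (b - (m' + 1)) := this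
          _ = _ := by ring
      have := le_trans c1 c2
      exact le_of_mul_le_mul_right this hppos

/-- (m4) iterated along the lines through `(a, b)` and `(a, b + 1)`:
`T (a+k) (b+1-k) * T (a+k') (b-k') ≤ T (a+k') (b+1-k') * T (a+k) (b-k)` for `k ≤ k'`. -/
lemma m4_iter (a b : ℤ) {k k' : ℤ} (h : k ≤ k') :
    T (a + k) (b + 1 - k) * T (a + k') (b - k') ≤ T (a + k') (b + 1 - k') * T (a + k) (b - k) := by
  obtain ⟨d, rfl⟩ : ∃ d : ℕ, k' = k + d := ⟨(k' - k).toNat, by omega⟩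
  induction d with
  | zero => simp
  | succ d ih =>
    have ih := ih (by omega)
    set k' := k + (d : ℤ) with hk'
    have e1 : k + ((d + 1 : ℕ) : ℤ) = k' + 1 := by rw [hk']; push_cast; ring
    rw [e1]
    -- one step of m4 at the base point (a + (k' + 1), b - (k' + 1))
    have step : T (a + k') (b + 1 - k') * T (a + (k' + 1)) (b - (k' + 1))
        ≤ T (a + (k' + 1)) (b + 1 - (k' + 1)) * T (a + k') (b - k') := by
      convert hT.m4 (a + (k' + 1)) (b - (k' + 1)) using 3 <;> ring
    by_cases hp : T (a + k') (b - k') = 0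
    · by_cases hp1 : T (a + (k' + 1)) (b - (k' + 1)) = 0
      · rw [hp1, mul_zero]; exact mul_nonneg (hT.nonneg _ _) (hT.nonneg _ _)
      · have hp1' : 0 < T (a + (k' + 1)) (b - (k' + 1)) := lt_of_le_of_ne (hT.nonneg _ _) (Ne.symm hp1)
        have hpk : T (a + k) (b - k) = 0 := hT.zero_left (by omega) hp hp1'
        have hr : T (a + k) (b + 1 - k) = 0 := by
          have := hT.anti₂ (a + k) (b - k)
          have e : b - k + 1 = b + 1 - k := by ring
          rw [e, hpk] at this
          exact le_antisymm this (hT.nonneg _ _)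
        rw [hr, zero_mul]; exact mul_nonneg (hT.nonneg _ _) (hT.nonneg _ _)
    · have hppos : 0 < T (a + k') (b - k') := lt_of_le_of_ne (hT.nonneg _ _) (Ne.symm hp)
      -- chain: r_k p_{k'+1} p_{k'} ≤ r_{k'} p_k p_{k'+1} ≤ r_{k'+1} p_{k'} p_k
      have c1 : T (a + k) (b + 1 - k) * T (a + (k' + 1)) (b - (k' + 1)) * T (a + k') (b - k')
          ≤ T (a + k') (b + 1 - k') * T (a + k) (b - k) * T (a + (k' + 1)) (b - (k' + 1)) := by
        have := mul_le_mul_of_nonneg_right ih (hT.nonneg (a + (k' + 1)) (b - (k' + 1)))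
        calc T (a + k) (b + 1 - k) * T (a + (k' + 1)) (b - (k' + 1)) * T (a + k') (b - k')
            = T (a + k) (b + 1 - k) * T (a + k') (b - k') * T (a + (k' + 1)) (b - (k' + 1)) := by ring
          _ ≤ _ := this
      have c2 : T (a + k') (b + 1 - k') * T (a + k) (b - k) * T (a + (k' + 1)) (b - (k' + 1))
          ≤ T (a + (k' + 1)) (b + 1 - (k' + 1)) * T (a + k) (b - k) * T (a + k') (b - k') := by
        have := mul_le_mul_of_nonneg_right step (hT.nonneg (a + k) (b - k))
        calc T (a + k') (b + 1 - k') * T (a + k) (b - k) * T (a + (k' + 1)) (b - (k' + 1))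
            = T (a + k') (b + 1 - k') * T (a + (k' + 1)) (b - (k' + 1)) * T (a + k) (b - k) := by ring
          _ ≤ T (a + (k' + 1)) (b + 1 - (k' + 1)) * T (a + k') (b - k') * T (a + k) (b - k) := this
          _ = _ := by ring
      exact le_of_mul_le_mul_right (le_trans c1 c2) hppos

/-- the cross lemma (one-sided): for `m ≤ m'`, with the three `w`-lines through `(a, b)`, `(a + 1, b)`
and `(a + 2, b)`, `r_{m'-1} p_m + r_{m-1} p_{m'} ≤ q_{m'} q_{m-1} + q_m q_{m'-1}`. -/
lemma cross_aux (a b : ℤ) {m m' : ℤ} (h : m ≤ m') :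
    T (a + 1 + m') (b + 1 - m') * T (a + m) (b - m) + T (a + 1 + m) (b + 1 - m) * T (a + m') (b - m')
      ≤ T (a + 1 + m') (b - m') * T (a + m) (b + 1 - m) + T (a + 1 + m) (b - m) * T (a + m') (b + 1 - m') := by
  -- (1) m1 at (a+m, b-m): r_{m-1} p_m ≤ q_m q_{m-1}
  have h1 : T (a + 1 + m) (b + 1 - m) * T (a + m) (b - m) ≤ T (a + 1 + m) (b - m) * T (a + m) (b + 1 - m) := by
    convert hT.m1 (a + m) (b - m) using 3 <;> ring
  -- (2) m1 at (a+m', b-m'): r_{m'-1} p_{m'} ≤ q_{m'} q_{m'-1}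
  have h2 : T (a + 1 + m') (b + 1 - m') * T (a + m') (b - m') ≤ T (a + 1 + m') (b - m') * T (a + m') (b + 1 - m') := by
    convert hT.m1 (a + m') (b - m') using 3 <;> ring
  -- (3) m4 iterated: q_{m-1} p_{m'} ≤ q_{m'-1} p_m
  have h3 := hT.m4_iter a b h
  -- (4) m2 iterated: q_{m'} p_m ≤ q_m p_{m'}
  have h4 := hT.m2_iter a b h
  -- monotonicity facts: r₀ ≤ α ≤ p₀ and rd ≤ γ ≤ pd
  have s1 : T (a + 1 + m) (b + 1 - m) ≤ T (a + m) (b + 1 - m) := by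
    have := hT.anti₁ (a + m) (b + 1 - m); rwa [show a + m + 1 = a + 1 + m by ring] at this
  have s2 : T (a + m) (b + 1 - m) ≤ T (a + m) (b - m) := by
    have := hT.anti₂ (a + m) (b - m); rwa [show b - m + 1 = b + 1 - m by ring] at this
  have s3 : T (a + 1 + m') (b + 1 - m') ≤ T (a + m') (b + 1 - m') := by
    have := hT.anti₁ (a + m') (b + 1 - m'); rwa [show a + m' + 1 = a + 1 + m' by ring] at this
  have s4 : T (a + m') (b + 1 - m') ≤ T (a + m') (b - m') := by
    have := hT.anti₂ (a + m') (b - m'); rwa [show b - m' + 1 = b + 1 - m' by ring] at this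
  have n0 := hT.nonneg (a + m) (b - m); have nd := hT.nonneg (a + m') (b - m')
  have nα := hT.nonneg (a + m) (b + 1 - m); have nβ := hT.nonneg (a + 1 + m) (b - m)
  have nγ := hT.nonneg (a + m') (b + 1 - m'); have nδ := hT.nonneg (a + 1 + m') (b - m')
  have nr₀ := hT.nonneg (a + 1 + m) (b + 1 - m); have nrd := hT.nonneg (a + 1 + m') (b + 1 - m')
  generalize hp₀ : T (a + m) (b - m) = p₀ at *
  generalize hpd : T (a + m') (b - m') = pd at *
  generalize hα : T (a + m) (b + 1 - m) = α at *
  generalize hβ : T (a + 1 + m) (b - m) = β at *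
  generalize hγ : T (a + m') (b + 1 - m') = γ at *
  generalize hδ : T (a + 1 + m') (b - m') = δ at *
  generalize hr₀ : T (a + 1 + m) (b + 1 - m) = r₀ at *
  generalize hrd : T (a + 1 + m') (b + 1 - m') = rd at *
  by_cases hz0 : p₀ = 0
  · have hr0z : r₀ = 0 := by rw [hz0] at s2; exact le_antisymm (le_trans s1 s2) nr₀
    rw [hz0, hr0z]; simp only [mul_zero, zero_mul, add_zero]
    exact add_nonneg (mul_nonneg nδ nα) (mul_nonneg nβ nγ)
  by_cases hzd : pd = 0
  · have hrdz : rd = 0 := by rw [hzd] at s4; exact le_antisymm (le_trans s3 s4) nrd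
    rw [hzd, hrdz]; simp only [mul_zero, zero_mul, zero_add]
    exact add_nonneg (mul_nonneg nδ nα) (mul_nonneg nβ nγ)
  have p0pos : 0 < p₀ := lt_of_le_of_ne n0 (Ne.symm hz0)
  have pdpos : 0 < pd := lt_of_le_of_ne nd (Ne.symm hzd)
  have key : 0 ≤ (δ * α + β * γ - rd * p₀ - r₀ * pd) * (p₀ * pd) := by
    have f1 : 0 ≤ γ * p₀ - α * pd := by linarith [h3]
    have f2 : 0 ≤ β * pd - δ * p₀ := by linarith [h4]
    have f3 : rd * p₀ * (p₀ * pd) ≤ δ * γ * (p₀ * p₀) := by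
      have := mul_le_mul_of_nonneg_right h2 (mul_nonneg n0 n0)
      calc rd * p₀ * (p₀ * pd) = rd * pd * (p₀ * p₀) := by ring
        _ ≤ δ * γ * (p₀ * p₀) := this
    have f4 : r₀ * pd * (p₀ * pd) ≤ β * α * (pd * pd) := by
      have := mul_le_mul_of_nonneg_right h1 (mul_nonneg nd nd)
      calc r₀ * pd * (p₀ * pd) = r₀ * p₀ * (pd * pd) := by ring
        _ ≤ β * α * (pd * pd) := this
    have f5 : 0 ≤ (γ * p₀ - α * pd) * (β * pd - δ * p₀) := mul_nonneg f1 f2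
    nlinarith [f3, f4, f5]
  have := (mul_nonneg_iff_of_pos_right (mul_pos p0pos pdpos)).mp key
  linarith

/-- the cross lemma, both orders of `m, m'` -/
lemma cross (a b m m' : ℤ) :
    T (a + 1 + m') (b + 1 - m') * T (a + m) (b - m) + T (a + 1 + m) (b + 1 - m) * T (a + m') (b - m')
      ≤ T (a + 1 + m') (b - m') * T (a + m) (b + 1 - m) + T (a + 1 + m) (b - m) * T (a + m') (b + 1 - m') := by
  rcases le_total m m' with h | h
  · exact hT.cross_aux a b h
  · have := hT.cross_aux a b h
    linarith

end IsMTail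

section Product

variable {T U : ℤ → ℤ → ℝ} {L M : ℤ} (hT : IsMTail T L) (hU : IsMTail U M)

include hT hU in
/-- **the series step**: the pointwise product of two M♮-concave tails is an M♮-concave tail (series
composition takes the minimum of the flows, so the tails multiply); the three exchange inequalities
multiply term by term. -/
theorem IsMTail.mul : IsMTail (fun a b => T a b * U a b) (min L M) where
  L_nonneg := le_min hT.L_nonneg hU.L_nonneg
  clip₁ := by intro a b h; show T a b * U a b = T 0 b * U 0 b; rw [hT.clip₁ a b h, hU.clip₁ a b h]
  clip₂ := by intro a b h; show T a b * U a b = T a 0 * U a 0; rw [hT.clip₂ a b h, hU.clip₂ a b h]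
  pos := by
    intro a b h; show 0 < T a b * U a b
    exact mul_pos (hT.pos a b (le_trans h (min_le_left _ _))) (hU.pos a b (le_trans h (min_le_right _ _)))
  zero := by
    intro a b h; show T a b * U a b = 0
    rcases le_total L M with hLM | hLM
    · rw [min_eq_left hLM] at h; rw [hT.zero a b h]; ring
    · rw [min_eq_right hLM] at h; rw [hU.zero a b h]; ring
  anti₁ := by
    intro a b; show T (a + 1) b * U (a + 1) b ≤ T a b * U a b
    exact mul_le_mul (hT.anti₁ a b) (hU.anti₁ a b) (hU.nonneg _ _) (hT.nonneg _ _)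
  anti₂ := by
    intro a b; show T a (b + 1) * U a (b + 1) ≤ T a b * U a b
    exact mul_le_mul (hT.anti₂ a b) (hU.anti₂ a b) (hU.nonneg _ _) (hT.nonneg _ _)
  m1 := by
    intro a b
    show T (a + 1) (b + 1) * U (a + 1) (b + 1) * (T a b * U a b) ≤ T (a + 1) b * U (a + 1) b * (T a (b + 1) * U a (b + 1))
    have := mul_le_mul (hT.m1 a b) (hU.m1 a b) (mul_nonneg (hU.nonneg _ _) (hU.nonneg _ _))
      (mul_nonneg (hT.nonneg _ _) (hT.nonneg _ _))
    calc T (a + 1) (b + 1) * U (a + 1) (b + 1) * (T a b * U a b)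
        = T (a + 1) (b + 1) * T a b * (U (a + 1) (b + 1) * U a b) := by ring
      _ ≤ T (a + 1) b * T a (b + 1) * (U (a + 1) b * U a (b + 1)) := this
      _ = T (a + 1) b * U (a + 1) b * (T a (b + 1) * U a (b + 1)) := by ring
  m2 := by
    intro a b
    show T (a + 2) (b - 1) * U (a + 2) (b - 1) * (T a b * U a b) ≤ T (a + 1) b * U (a + 1) b * (T (a + 1) (b - 1) * U (a + 1) (b - 1))
    have := mul_le_mul (hT.m2 a b) (hU.m2 a b) (mul_nonneg (hU.nonneg _ _) (hU.nonneg _ _))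
      (mul_nonneg (hT.nonneg _ _) (hT.nonneg _ _))
    calc T (a + 2) (b - 1) * U (a + 2) (b - 1) * (T a b * U a b)
        = T (a + 2) (b - 1) * T a b * (U (a + 2) (b - 1) * U a b) := by ring
      _ ≤ T (a + 1) b * T (a + 1) (b - 1) * (U (a + 1) b * U (a + 1) (b - 1)) := this
      _ = T (a + 1) b * U (a + 1) b * (T (a + 1) (b - 1) * U (a + 1) (b - 1)) := by ring
  m4 := by
    intro a b
    show T (a - 1) (b + 2) * U (a - 1) (b + 2) * (T a b * U a b) ≤ T a (b + 1) * U a (b + 1) * (T (a - 1) (b + 1) * U (a - 1) (b + 1))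
    have := mul_le_mul (hT.m4 a b) (hU.m4 a b) (mul_nonneg (hU.nonneg _ _) (hU.nonneg _ _))
      (mul_nonneg (hT.nonneg _ _) (hT.nonneg _ _))
    calc T (a - 1) (b + 2) * U (a - 1) (b + 2) * (T a b * U a b)
        = T (a - 1) (b + 2) * T a b * (U (a - 1) (b + 2) * U a b) := by ring
      _ ≤ T a (b + 1) * T (a - 1) (b + 1) * (U a (b + 1) * U (a - 1) (b + 1)) := this
      _ = T a (b + 1) * U a (b + 1) * (T (a - 1) (b + 1) * U (a - 1) (b + 1)) := by ring

end Product

section Point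

/-- the tail of the point mass at `(0, 0)` (the empty network: no red and no blue path) -/
noncomputable def pt (a b : ℤ) : ℝ := if a ≤ 0 ∧ b ≤ 0 then 1 else 0

/-- the point mass is an M♮-concave tail with top level `0` -/
theorem pt_isMTail : IsMTail pt 0 where
  L_nonneg := le_rfl
  clip₁ := by intro a b h; unfold pt; simp [h]
  clip₂ := by intro a b h; unfold pt; simp [h]
  pos := by
    intro a b h; unfold pt
    have hab : a ≤ 0 ∧ b ≤ 0 := by omega
    simp [hab]
  zero := by
    intro a b h; unfold pt
    have hab : ¬ (a ≤ 0 ∧ b ≤ 0) := by omega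
    simp [hab]
  anti₁ := by
    intro a b; unfold pt; split_ifs <;> norm_num
    omega
  anti₂ := by
    intro a b; unfold pt; split_ifs <;> norm_num
    omega
  m1 := by intro a b; unfold pt; split_ifs <;> norm_num <;> omega
  m2 := by intro a b; unfold pt; split_ifs <;> norm_num <;> omega
  m4 := by intro a b; unfold pt; split_ifs <;> norm_num <;> omega

end Point

section Swap

variable {T : ℤ → ℤ → ℝ} {L : ℤ} (hT : IsMTail T L)

include hT in
/-- the colour swap: `(a, b) ↦ T b a` is again an M♮-concave tail (`m2` and `m4` exchange roles) -/
theorem IsMTail.swap : IsMTail (fun a b => T b a) L where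
  L_nonneg := hT.L_nonneg
  clip₁ := fun a b h => hT.clip₂ b a h
  clip₂ := fun a b h => hT.clip₁ b a h
  pos := fun a b h => hT.pos b a (by omega)
  zero := fun a b h => hT.zero b a (by omega)
  anti₁ := fun a b => hT.anti₂ b a
  anti₂ := fun a b => hT.anti₁ b a
  m1 := fun a b => by have := hT.m1 b a; linarith [this]
  m2 := fun a b => by have := hT.m4 b a; linarith [this]
  m4 := fun a b => by have := hT.m2 b a; linarith [this]

end Swap

end Summit.Ventures.PercRepro2.Tail2D
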